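import Mathlib
import Summits.NavierStokesRegularity.NavierStokesRegularity.Theorems.EulerZoomLiouvillePowerGaugeEulerLiouvilleNeedleAxisymAnyAxisPast
import Summits.NavierStokesRegularity.NavierStokesRegularity.Theorems.EulerZoomLiouvillePowerGaugeEulerLiouvilleSelfSimilarSwirlRatchetAnyAxis
import HarnessLib

/-!
# Crux E `PowerGaugeEulerLiouville` (stmt-NavierStokesRegularity-19832): the GENERIC CONJUGATION LEMMA for PAST-EXACT members — any profile stratum of the
# past/shifted self-similar branch can sit under one `∃ R` (width seat ns-ezl-w3 g3; by-name request of LEAD g12, v66: «until a generic past conj transport exists»)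

Route №10 `EulerZoomLiouville` (NavierStokesRegularity), crux E.  Past twin of `ClassIsometry.selfSimilar_ae_eq_zero_of_conj` (p643199): a member exactly self-similar
about `(T, x₀)` on a past window `τ < T₁` with profile `(V, P)` is trivial as soon as every class member (same constant) that is exactly self-similar about `(T, R x₀)`
on the same window with the CONJUGATED profile `(y ↦ R V(R⁻¹ y), P ∘ R⁻¹)` is trivial — the conjugated member of ns-ezl-w2 g3's `…ClassIsometry` (p642230) is
past-exact about `(T, R x₀)` by `NeedleRace.selfSimilarCollapse_conj_shifted` (p642901), and the a.e. vanishing pulls back along the measure-preserving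
`(s, x) ↦ (s, R x)`.  With it the LEAD's `IsTameSwirlPast` (five past twins) and every other past profile stratum take the `∃ R` form by one `obtain`.

WHAT THIS IS NOT: not NS regularity, not the crux E — by-name transport for strata of the crux CLASS 19832 (MODEL lattice; E/NS strata) `--supports` stmt-19832; 19832 OPEN.
[folklore; MajdaBertozziCUP2002 §1.2 Prop. 1.1 (iii)]
-/

noncomputable section

-- flat `Theorems/<Route><Decl>…` files of one crux share the namespace of the crux (tree convention: `Summit.<S>.<S>.…`)
set_option linter.dupNamespace false

open MeasureTheory Set Filter Topology Metric Function InnerProductSpace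
open scoped RealInnerProductSpace NNReal ContDiff

namespace Summit.NavierStokesRegularity.NavierStokesRegularity.Theorems.PowerGaugeEulerLiouville

open Literature.Analysis Literature.Analysis.FluidPDE Literature.Analysis.FunctionSpaces

namespace ClassIsometry

variable {u : ℝ → EuclideanSpace ℝ (Fin 3) → EuclideanSpace ℝ (Fin 3)} {p : ℝ → EuclideanSpace ℝ (Fin 3) → ℝ}
  {H : ℝ → EuclideanSpace ℝ (Fin 3) → EuclideanSpace ℝ (Fin 3) →L[ℝ] EuclideanSpace ℝ (Fin 3)} {c : ℝ≥0}
  {V : EuclideanSpace ℝ (Fin 3) → EuclideanSpace ℝ (Fin 3)} {P : EuclideanSpace ℝ (Fin 3) → ℝ}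

/-- **GENERIC CONJUGATION LEMMA FOR PAST-EXACT SELF-SIMILAR MEMBERS.**  Crux binders verbatim (suitable weak Euler on `(−∞,0) × ℝ³`, weak gradient `H`, gauges with exponent
`ρ` bounded by `c`) + velocity AND pressure exactly self-similar about `(T, x₀)` at rate `γ` on the window `τ < T₁` with profile `(V, P)`; `R` a linear isometry of `ℝ³`.  If
EVERY triple `(u′, p′, H′)` satisfying the three crux binders whose velocity/pressure are, for `τ < T₁`, the ansatz about `(T, R x₀)` of the CONJUGATED profile
`(y ↦ R V(R⁻¹ y), y ↦ P(R⁻¹ y))` is a.e. zero on the slab, then so is `u`. [folklore; MajdaBertozziCUP2002 §1.2 Prop. 1.1 (iii)] -/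
theorem pastSelfSimilar_ae_eq_zero_of_conj {ρ γ T T₁ : ℝ} (x₀ : EuclideanSpace ℝ (Fin 3))
    (hsw : IsSuitableWeakSolutionOn (slab (EuclideanSpace ℝ (Fin 3)) (Iio 0) isOpen_Iio) 0 0 u p)
    (hH : HasWeakSpatialGradientOn (slab (EuclideanSpace ℝ (Fin 3)) (Iio 0) isOpen_Iio) u H)
    (hgauge : ∀ a : ℝ, 0 < a →
      ENNReal.ofReal (a ^ (2 * ρ)) * cknA a (0 : ℝ × EuclideanSpace ℝ (Fin 3)) u +
          ENNReal.ofReal (a ^ ρ) * cknE a (0 : ℝ × EuclideanSpace ℝ (Fin 3)) H +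
        ENNReal.ofReal (a ^ (2 * ρ)) * cknD a (0 : ℝ × EuclideanSpace ℝ (Fin 3)) p ≤ (c : ENNReal))
    (hu : ∀ τ : ℝ, τ < T₁ → u τ = fun x => selfSimilarCollapse γ T V τ (x - x₀))
    (hp : ∀ τ : ℝ, τ < T₁ → p τ = fun x => selfSimilarCollapsePressure γ T P τ (x - x₀))
    (R : EuclideanSpace ℝ (Fin 3) ≃ₗᵢ[ℝ] EuclideanSpace ℝ (Fin 3))
    (hkill : ∀ (u' : ℝ → EuclideanSpace ℝ (Fin 3) → EuclideanSpace ℝ (Fin 3)) (p' : ℝ → EuclideanSpace ℝ (Fin 3) → ℝ)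
        (H' : ℝ → EuclideanSpace ℝ (Fin 3) → EuclideanSpace ℝ (Fin 3) →L[ℝ] EuclideanSpace ℝ (Fin 3)),
      IsSuitableWeakSolutionOn (slab (EuclideanSpace ℝ (Fin 3)) (Iio 0) isOpen_Iio) 0 0 u' p' →
      HasWeakSpatialGradientOn (slab (EuclideanSpace ℝ (Fin 3)) (Iio 0) isOpen_Iio) u' H' →
      (∀ a : ℝ, 0 < a →
        ENNReal.ofReal (a ^ (2 * ρ)) * cknA a (0 : ℝ × EuclideanSpace ℝ (Fin 3)) u' +
            ENNReal.ofReal (a ^ ρ) * cknE a (0 : ℝ × EuclideanSpace ℝ (Fin 3)) H' +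
          ENNReal.ofReal (a ^ (2 * ρ)) * cknD a (0 : ℝ × EuclideanSpace ℝ (Fin 3)) p' ≤ (c : ENNReal)) →
      (∀ τ : ℝ, τ < T₁ → u' τ = fun x => selfSimilarCollapse γ T (fun y => R (V (R.symm y))) τ (x - R x₀)) →
      (∀ τ : ℝ, τ < T₁ → p' τ = fun x => selfSimilarCollapsePressure γ T (fun y => P (R.symm y)) τ (x - R x₀)) →
      uncurry u' =ᵐ[volume.restrict (Iio (0 : ℝ) ×ˢ (univ : Set (EuclideanSpace ℝ (Fin 3))))] 0) :
    uncurry u =ᵐ[volume.restrict (Iio (0 : ℝ) ×ˢ (univ : Set (EuclideanSpace ℝ (Fin 3))))] 0 := by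
  -- adapted from `ClassIsometry.selfSimilar_ae_eq_zero_of_conj` and ns-ezl-w2 g3's `NeedleRace.selfSimilar_ae_eq_zero_of_axisymNoSwirlC2_past_conj`
  have hsw' := isSuitableWeakSolutionOn_conj_isometry isOpen_Iio hsw R
  have hf0 : (fun (s : ℝ) (x : EuclideanSpace ℝ (Fin 3)) =>
      R ((0 : ℝ → EuclideanSpace ℝ (Fin 3) → EuclideanSpace ℝ (Fin 3)) s (R.symm x))) = 0 := by
    funext s x
    simp
  rw [hf0] at hsw'
  have hH' := hasWeakSpatialGradientOn_conj_isometry isOpen_Iio hH R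
  have hgauge' := gauge_conj_isometry R hgauge
  have hu' : ∀ τ : ℝ, τ < T₁ → (fun s x => R (u s (R.symm x))) τ =
      fun x => selfSimilarCollapse γ T (fun y => R (V (R.symm y))) τ (x - R x₀) := by
    intro τ hτ
    funext x
    simp only [hu τ hτ, NeedleRace.selfSimilarCollapse_conj_shifted]
  have hp' : ∀ τ : ℝ, τ < T₁ → (fun s x => p s (R.symm x)) τ =
      fun x => selfSimilarCollapsePressure γ T (fun y => P (R.symm y)) τ (x - R x₀) := by
    intro τ hτ
    funext x
    simp only [hp τ hτ, NeedleRace.selfSimilarCollapsePressure_conj_shifted]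
  have h' := hkill _ _ _ hsw' hH' hgauge' hu' hp'
  -- pull the vanishing back along `(s, x) ↦ (s, R x)`
  set Ψ : ℝ × EuclideanSpace ℝ (Fin 3) → ℝ × EuclideanSpace ℝ (Fin 3) := fun z => (z.1, R z.2) with hΨ
  have hΨmp : MeasurePreserving Ψ
      (volume.restrict (Iio (0 : ℝ) ×ˢ (univ : Set (EuclideanSpace ℝ (Fin 3)))))
      (volume.restrict (Iio (0 : ℝ) ×ˢ (univ : Set (EuclideanSpace ℝ (Fin 3))))) := by
    have h1 := (PressureSlaving.measurePreserving_prod_isometry R).restrict_preimage_emb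
      (PressureSlaving.measurableEmbedding_prod_isometry R) (Iio (0 : ℝ) ×ˢ (univ : Set (EuclideanSpace ℝ (Fin 3))))
    rwa [PressureSlaving.preimage_prod_isometry_slab] at h1
  have h2 : ∀ᵐ z ∂(volume.restrict (Iio (0 : ℝ) ×ˢ (univ : Set (EuclideanSpace ℝ (Fin 3))))),
      uncurry (fun s x => R (u s (R.symm x))) (Ψ z) = (0 : ℝ × EuclideanSpace ℝ (Fin 3) → EuclideanSpace ℝ (Fin 3)) (Ψ z) :=
    hΨmp.quasiMeasurePreserving.tendsto_ae.eventually h'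
  filter_upwards [h2] with z hz
  have hz' : R (u z.1 z.2) = 0 := by simpa [hΨ, uncurry] using hz
  show u z.1 z.2 = 0
  simpa using hz'

end ClassIsometry

/-! ### Instance: the bounded-swirl past stratum about any axis -/

namespace SwirlRatchet

variable {u : ℝ → EuclideanSpace ℝ (Fin 3) → EuclideanSpace ℝ (Fin 3)} {p : ℝ → EuclideanSpace ℝ (Fin 3) → ℝ}
  {H : ℝ → EuclideanSpace ℝ (Fin 3) → EuclideanSpace ℝ (Fin 3) →L[ℝ] EuclideanSpace ℝ (Fin 3)} {c : ℝ≥0}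
  {V : EuclideanSpace ℝ (Fin 3) → EuclideanSpace ℝ (Fin 3)} {P : EuclideanSpace ℝ (Fin 3) → ℝ}

/-- **PAST + ANY AXIS: bounded swirl.**  `…_of_axisym_boundedSwirl_C2_past` with `IsAxisymmetric` and the swirl bound read on the conjugated profile `y ↦ R V(R⁻¹ y)` (linear
growth stays on `V`) — the template for the LEAD's `∃ R` form of `IsTameSwirlPast`. [cite: Chae2007CMPEuler, Thm 2.2 + Note added p. 6] -/
theorem selfSimilar_ae_eq_zero_of_axisym_boundedSwirl_C2_past_conj {ρ T T₁ : ℝ} (hρ : 0 < ρ) (hρ1 : ρ ≤ 1 / 2)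
    (hT₁ : T₁ ≤ 0) (hTT₁ : T₁ ≤ T) (x₀ : EuclideanSpace ℝ (Fin 3))
    (hsw : IsSuitableWeakSolutionOn (slab (EuclideanSpace ℝ (Fin 3)) (Iio 0) isOpen_Iio) 0 0 u p)
    (hH : HasWeakSpatialGradientOn (slab (EuclideanSpace ℝ (Fin 3)) (Iio 0) isOpen_Iio) u H)
    (hgauge : ∀ a : ℝ, 0 < a →
      ENNReal.ofReal (a ^ (2 * ρ)) * cknA a (0 : ℝ × EuclideanSpace ℝ (Fin 3)) u +
          ENNReal.ofReal (a ^ ρ) * cknE a (0 : ℝ × EuclideanSpace ℝ (Fin 3)) H +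
        ENNReal.ofReal (a ^ (2 * ρ)) * cknD a (0 : ℝ × EuclideanSpace ℝ (Fin 3)) p ≤ (c : ENNReal))
    (hu : ∀ τ : ℝ, τ < T₁ → u τ = fun x => selfSimilarCollapse (1 / (2 + ρ)) T V τ (x - x₀))
    (hp : ∀ τ : ℝ, τ < T₁ → p τ = fun x => selfSimilarCollapsePressure (1 / (2 + ρ)) T P τ (x - x₀))
    (hV : ContDiff ℝ 2 V) (hlin : ∃ K₁ : ℝ, ∀ y, ‖V y‖ ≤ K₁ * (1 + ‖y‖))
    (R : EuclideanSpace ℝ (Fin 3) ≃ₗᵢ[ℝ] EuclideanSpace ℝ (Fin 3))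
    (hax : IsAxisymmetric (fun y => R (V (R.symm y))))
    (hbdd : ∃ B : ℝ, ∀ y, |swirl (fun y => R (V (R.symm y))) y| ≤ B) :
    uncurry u =ᵐ[volume.restrict (Iio (0 : ℝ) ×ˢ (univ : Set (EuclideanSpace ℝ (Fin 3))))] 0 := by
  obtain ⟨K₁, hK₁⟩ := hlin
  have hV' : ContDiff ℝ 2 (fun y => R (V (R.symm y))) :=
    R.toContinuousLinearEquiv.contDiff.comp (hV.comp R.symm.toContinuousLinearEquiv.contDiff)
  exact ClassIsometry.pastSelfSimilar_ae_eq_zero_of_conj x₀ hsw hH hgauge hu hp R fun u' p' H' hsw' hH' hg' hu' hp' =>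
    selfSimilar_ae_eq_zero_of_axisym_boundedSwirl_C2_past hρ hρ1 hT₁ hTT₁ (R x₀) hsw' hH' hg' hu' hp' hV' hax
      ⟨K₁, ClassIsometry.linearGrowth_conj R hK₁⟩ hbdd

end SwirlRatchet

end Summit.NavierStokesRegularity.NavierStokesRegularity.Theorems.PowerGaugeEulerLiouville

end
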